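import Summits.KontsevichZagierPeriods.KontsevichZagierPeriods.Theses.CommonUnfolding

/-!
# `Assembly` (stmt-KontsevichZagierPeriods-4832, route CommonUnfolding) — proof

The route's assembly item `CommonUnfoldingThesis → KontsevichZagierPeriods` (soundness of descents)
is the CONTENT of its gate-verified deciding theorem
`Summit.KontsevichZagierPeriods.KontsevichZagierPeriods.Theses.CommonUnfolding.closes
(hP : PeakNormalForm) (hC : UnfoldingComplement)`, whose first line forms the target
`hX : CommonUnfoldingThesis := hC hP` and whose remaining lines consume `hX` only. Since neither
`PeakNormalForm` nor `UnfoldingComplement` is a hypothesis of the assembly chain, `closes` cannot be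
applied as a term; instead its proof from `hX` on is reproduced VERBATIM (route file rev of
2026-08-16, D-0027 §2.1): (1) level moves are relations — domain/integrand additivity are rules
1a/1b, a coordinate permutation `x ↦ x ∘ p` is a change of variables (rule 2: a `ℚ`-polynomial map,
injective, its own derivative, `|det| = 1`); (2) one round `C ⟶ ∑ [bᵢ]` is
`C − ∑ [bᵢ] = (C − ∑ [Bᵢ]) + ∑ ([Bᵢ] − [bᵢ])`, a level move plus Newton–Leibniz moves (rule 3),
and a chain of rounds telescopes along `Relation.ReflTransGen`; (3) the two descents from the common
peak `[R]` telescope: `[r] − [r'] = ([R] − c') + (c' − [r']) − ([R] − c) − (c − [r])`.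
The antecedent `CommonUnfoldingThesis` (the route's summit-strength target) is NOT discharged here:
the theorem is the implication, nothing more. (Lead c10 of crux stmt-KontsevichZagierPeriods-9129,
banking.) No definitions are introduced.

References: M. Kontsevich, D. Zagier, *Periods* (2001), §1.2, Conjecture 1 and rules 1)–3).
-/

namespace Summit.KontsevichZagierPeriods.CommonUnfolding

open Set Function MeasureTheory

/-- **Assembly of route CommonUnfolding** (stmt-KontsevichZagierPeriods-4832):
`CommonUnfoldingThesis → KontsevichZagierPeriods`. If two KZ-rational representations with equal
values have a common unfolding (a peak `R` and two chains of forward Newton–Leibniz rounds from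
`[R]`, ending level-equivalent to `[r]` and to `[r']`), they are KZ-equivalent: level moves
(rules 1a, 1b, coordinate permutations as `|det| = 1` changes of variables) and Newton–Leibniz
rounds are relations, and the two descents telescope. Proof reproduced from the route's deciding
theorem `closes` (which consumes exactly this target). [Kontsevich–Zagier 2001, §1.2] [folklore] -/
theorem assembly_proof :
    Summit.KontsevichZagierPeriods.KontsevichZagierPeriods.Theses.CommonUnfolding.Assembly := by
  intro hX n m r r' hr hr' hv
  obtain ⟨N, R, c, c', hc, hc', hcr, hcr'⟩ := hX r r' hr hr' hv
  -- (1) LEVEL MOVES ARE RELATIONS: domain/integrand additivity are moves (1a)/(1b); a coordinate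
  -- permutation `x ↦ x ∘ p` is a change-of-variables move (2): a `ℚ`-polynomial map, injective,
  -- its own derivative (the permutation matrix), `|det| = 1`.
  have hLv : AddSubgroup.closure (Literature.NumberTheory.Transcendental.KZ.domainAddRel ∪
      Literature.NumberTheory.Transcendental.KZ.integrandAddRel ∪
      {c : Literature.NumberTheory.Transcendental.KZ.FormalRep | ∃ (d : ℕ)
        (s s' : Literature.NumberTheory.Transcendental.KZ.IntegralRep d) (p : Equiv.Perm (Fin d)),
        s'.domain = (fun x : Fin d → ℝ => x ∘ ⇑p) '' s.domain ∧
        (∀ x ∈ s.domain, s.integrand x = s'.integrand (x ∘ ⇑p)) ∧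
        c = Literature.NumberTheory.Transcendental.KZ.of s -
          Literature.NumberTheory.Transcendental.KZ.of s'}) ≤
      Literature.NumberTheory.Transcendental.KZ.relations := by
    refine (AddSubgroup.closure_le _).mpr ?_
    rintro x ((hx | hx) | ⟨d, s, s', p, hdom, hint, rfl⟩)
    · exact Literature.NumberTheory.Transcendental.KZ.domainAddRel_subset_relations hx
    · exact Literature.NumberTheory.Transcendental.KZ.integrandAddRel_subset_relations hx
    · refine Literature.NumberTheory.Transcendental.KZ.changeOfVariablesRel_subset_relations ?_
      let M : Matrix (Fin d) (Fin d) ℝ := (1 : Matrix (Fin d) (Fin d) ℝ).submatrix p (Equiv.refl _)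
      let L : (Fin d → ℝ) →L[ℝ] (Fin d → ℝ) := LinearMap.toContinuousLinearMap (Matrix.toLin' M)
      have hL : ∀ z : Fin d → ℝ, L z = fun j => z (p j) := by
        intro z
        change Matrix.toLin' M z = _
        rw [Matrix.toLin'_apply, Matrix.submatrix_mulVec_equiv, Matrix.one_mulVec]
        rfl
      have hdet : |L.det| = 1 := by
        change |LinearMap.det (Matrix.toLin' M)| = 1
        rw [LinearMap.det_toLin', Matrix.abs_det_submatrix_equiv_equiv, Matrix.det_one, abs_one]
      refine ⟨d, s, s', fun x => x ∘ ⇑p, fun _ => L, ?_, ?_, ?_, hdom, ?_, rfl⟩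
      · convert Literature.NumberTheory.Transcendental.isSemialgebraicMapOn_aeval
          s.isSemialgebraic_domain (fun j => (MvPolynomial.X (p j) : MvPolynomial (Fin d) ℚ))
          using 2 with z
        ext j; simp
      · intro z _
        have h := L.hasFDerivWithinAt (s := s.domain) (x := z)
        convert h using 1
        ext z' j
        rw [hL]
        rfl
      · intro z₁ _ z₂ _ h
        ext i
        have := congrFun h (p.symm i)
        simpa using this
      · intro z hz
        rw [hdet, mul_one]
        exact hint z hz
  -- (2) A CHAIN OF ROUNDS IS A RELATION: one round `C ⟶ ∑ [bᵢ]` is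
  -- `C − ∑ [bᵢ] = (C − ∑ [Bᵢ]) + ∑ ([Bᵢ] − [bᵢ])`, a level move plus Newton–Leibniz moves (3);
  -- then induct along `Relation.ReflTransGen`, telescoping.
  have hchain : ∀ {C c₀ : Literature.NumberTheory.Transcendental.KZ.FormalRep},
      Relation.ReflTransGen (fun C c => ∃ (d k : ℕ)
        (B : Fin k → Literature.NumberTheory.Transcendental.KZ.IntegralRep (d + 1))
        (b : Fin k → Literature.NumberTheory.Transcendental.KZ.IntegralRep d),
        (∀ i, Literature.NumberTheory.Transcendental.KZ.of (B i) -
          Literature.NumberTheory.Transcendental.KZ.of (b i) ∈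
            Literature.NumberTheory.Transcendental.KZ.newtonLeibnizRel) ∧
        C - ∑ i, Literature.NumberTheory.Transcendental.KZ.of (B i) ∈
          AddSubgroup.closure (Literature.NumberTheory.Transcendental.KZ.domainAddRel ∪
            Literature.NumberTheory.Transcendental.KZ.integrandAddRel ∪
            {c : Literature.NumberTheory.Transcendental.KZ.FormalRep | ∃ (d : ℕ)
              (s s' : Literature.NumberTheory.Transcendental.KZ.IntegralRep d)
              (p : Equiv.Perm (Fin d)),
              s'.domain = (fun x : Fin d → ℝ => x ∘ ⇑p) '' s.domain ∧
              (∀ x ∈ s.domain, s.integrand x = s'.integrand (x ∘ ⇑p)) ∧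
              c = Literature.NumberTheory.Transcendental.KZ.of s -
                Literature.NumberTheory.Transcendental.KZ.of s'}) ∧
        c = ∑ i, Literature.NumberTheory.Transcendental.KZ.of (b i)) C c₀ →
      C - c₀ ∈ Literature.NumberTheory.Transcendental.KZ.relations := by
    intro C c₀ h
    induction h with
    | refl =>
      rw [sub_self]
      exact Literature.NumberTheory.Transcendental.KZ.relations.zero_mem
    | @tail b₀ c₁ _ hbc ih =>
      obtain ⟨d, k, B, b, hNL, hB, rfl⟩ := hbc
      have hsum : ∑ i, (Literature.NumberTheory.Transcendental.KZ.of (B i) -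
          Literature.NumberTheory.Transcendental.KZ.of (b i)) ∈
            Literature.NumberTheory.Transcendental.KZ.relations :=
        sum_mem fun i _ =>
          Literature.NumberTheory.Transcendental.KZ.newtonLeibnizRel_subset_relations (hNL i)
      have key : C - ∑ i, Literature.NumberTheory.Transcendental.KZ.of (b i) =
          (C - b₀) + ((b₀ - ∑ i, Literature.NumberTheory.Transcendental.KZ.of (B i)) +
            ∑ i, (Literature.NumberTheory.Transcendental.KZ.of (B i) -
              Literature.NumberTheory.Transcendental.KZ.of (b i))) := by
        rw [Finset.sum_sub_distrib]
        abel
      rw [key]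
      exact add_mem ih (add_mem (hLv hB) hsum)
  -- (3) TELESCOPE: `[r] − [r'] = ([R] − c') + (c' − [r']) − ([R] − c) − (c − [r])`.
  have h₁ := hchain hc
  have h₂ := hchain hc'
  have h₃ := hLv hcr
  have h₄ := hLv hcr'
  show Literature.NumberTheory.Transcendental.KZ.of r -
      Literature.NumberTheory.Transcendental.KZ.of r' ∈
      Literature.NumberTheory.Transcendental.KZ.relations
  have key : Literature.NumberTheory.Transcendental.KZ.of r -
      Literature.NumberTheory.Transcendental.KZ.of r' =
      (Literature.NumberTheory.Transcendental.KZ.of R - c') +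
        (c' - Literature.NumberTheory.Transcendental.KZ.of r') -
        (Literature.NumberTheory.Transcendental.KZ.of R - c) -
        (c - Literature.NumberTheory.Transcendental.KZ.of r) := by
    abel
  rw [key]
  exact sub_mem (sub_mem (add_mem h₂ h₄) h₁) h₃

end Summit.KontsevichZagierPeriods.CommonUnfolding
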